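import Summits.QuantumFields.YangMills.Theorems.BalabanUVNodesN15TwoGridLandauGramRate
import Literature.MathematicalPhysics.QuantumFieldTheory.Balaban1983to89.B5PBridgeGreenInverse
import Literature.MathematicalPhysics.QuantumFieldTheory.King1986.MinimizerTowerBridge
import HarnessLib

/-!
# Route «BalabanUVNodes», node N15 = NE2, -a lane, part 50: DOOR (iv) — THE DICTIONARY b04 `K_T = G′Q′*` ↔ KING's MINIMISER `a·A₀⁻¹Qᵀ` AT `m² = 0`:
# `KRe n a M (torIdx x) (torIdx b) = a⁻¹·ℋ(x, b)` and `DKRe … μ = a⁻¹·n·(ℋ(x + e_μ, b) − ℋ(x, b))`, `ℋ = King1986.minimiser n M a n² 0 δ_b`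

Cell `pub-ymgap`, seat `pub-ymgap-dag-n15-a` (KNIT-BY-NAME, g12); `--supports stmt-QuantumFields-20290 --as helper`; `HOME/pub-ymgap-dag-n15-a/DOOR-IV-PLAN.md` §7.4(a).
Over part 49 (`hasMaj_twoGridDefect_of_kernelPairRates`), lit-balaban∕b05's P-bridge (`B5PBridgeGreenInverse.KTvec_eq_greenInv_mulVec`: r02's `K_T`-vector IS `(Δ + aQ′*Q′)⁻¹Q′*ω`,
`greenOp_mul_inv`; `B5GreenBridgeP12Green.KTvec`∕`repZ`∕`castU`; `B5GreenBridgeP12Dict.QsAdj_mulVec`; `B5Action121.LapS_mulVec`; `B5RealFields` (`IsReal`, `reM`, `IsReal.cplx_mulVec`,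
`IsReal.reM_inv`, `isReal_LapS`, `isReal_QsOp`)), King's typed block-spin objects (`King1986.EffectiveLaplacianSymbol`: `minimiser`, `fineOp = lapF + a•blockProj`, `Qmat`,
`transpose_Qmat_mulVec`; `MinimizerTowerBridge.lapF_mulVec_apply`; `TorusBlockForm.blockProj`, `site_eq_bpt`), n15-a parts 1∕39 (`DefectKernel.sum_fibre_blockOf`,
`blockLabel_eq_blockOf`), b05's (1.126) engine (`B5QGGQ145Factor.KRe`, `B5DPD126Uniform.DKRe`∕`DKRe_eq_fdiff`, `B5PBridgeKernel126.torIdx_add_unitVec`).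
WHAT.  (§51) `Re(Δ + aQ′*Q′) = A₀(a, n², 0)`: ★ `reM_greenOp_eq_fineOp` — b05's typed complex operator `LapS (fine n M) n + a•(QsAdj·QsOp)` has real part King's `fineOp n M a (n²) 0` (stencils
`LapS_mulVec` ∕ `lapF_mulVec_apply`, block means `QsAdj_mulVec`∕`QsOp_mulVec` ∕ `blockProj`).  (§52) charts: `repZ = toZ ∘ torIdx`, `castU (toZ (torIdx b)) = b`, the box point of `b`;
`KTvec` of an indicator = one kernel value.  (§53) ★★ **`KRe_torIdx_eq_minimiser`**: `KRe n a M (torIdx x) (torIdx b) = a⁻¹ · minimiser n M a (n²) 0 (δ_b) x` and ★★ **`DKRe_torIdx_eq_minimiser`**: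
`DKRe n a M μ (torIdx x) (torIdx b) = a⁻¹·n·(minimiser … (x + e_μ) − minimiser … x)` — b04's torus Green kernel `K_T` of `(Δ + aQ′*Q′)⁻¹Q′*` at `m² = 0` IS King's block-spin
minimiser kernel `ℋ = a·A₀⁻¹Qᵀ` (2.13)–(2.15) at `c = n²`, `m² = 0`, divided by `a`.  So King's Prop. 3.8 (3.71) lines 1–2 (tree, for `ℋ` with `m² > 0`, mass-uniform) are statements about
`KRe`∕`DKRe` once `m² → 0⁺` (next file).
HONEST FRAMING ∕ LIMITS.  Pure dictionary (finite-dimensional linear algebra + index charts); no estimate; nothing of [B5] ∕ [King1986] asserted beyond the typed objects; `U ≡ 1`;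
count-neutral (typed 28∕28 · discharged 5∕28 unchanged); NOT a discharge of N15 (object-bound; NE2⁺ NOT PRINTED); one finite T⁴ at fixed ε — NOT infinite volume, NOT OS on ℝ⁴,
NOT a mass gap, NOT Clay.
-/

noncomputable section

open scoped BigOperators Matrix ComplexConjugate
open Finset

namespace Summit.QuantumFields.YangMills.BalabanUVNodes.N15.TwoGrid

open Literature.MathematicalPhysics.QuantumFieldTheory.Balaban1983to89
open Literature.MathematicalPhysics.QuantumFieldTheory.Balaban1983to89.T4EtaRateCoeffDefect (fibre mem_fibre)
open Literature.MathematicalPhysics.QuantumFieldTheory.Balaban1983to89.B5Prop11Plancherel (Tor fine unitVec)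
open Literature.MathematicalPhysics.QuantumFieldTheory.Balaban1983to89.B5Action121 (LapS LapS_mulVec)
open Literature.MathematicalPhysics.QuantumFieldTheory.Balaban1983to89.B5Block118 (QsOp QsOp_mulVec bpt)
open Literature.MathematicalPhysics.QuantumFieldTheory.Balaban1983to89.B5Hk160Torus (QsAdj)
open Literature.MathematicalPhysics.QuantumFieldTheory.Balaban1983to89.B5RealFields (IsReal reM cplx isReal_LapS isReal_QsOp reM_add reM_smul_ofReal)
open Literature.MathematicalPhysics.QuantumFieldTheory.Balaban1983to89.B5Cube1Partition (blockLabel)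
open Literature.MathematicalPhysics.QuantumFieldTheory.Balaban1983to89.B5GreenBridgeP12Green (KTvec repZ castU)
open Literature.MathematicalPhysics.QuantumFieldTheory.Balaban1983to89.B5GreenBridgeP12Dict (QsAdj_mulVec)
open Literature.MathematicalPhysics.QuantumFieldTheory.Balaban1983to89.B5PBridgeGreenInverse (greenOp_mul_inv KTvec_eq_greenInv_mulVec)
open Literature.MathematicalPhysics.QuantumFieldTheory.Balaban1983to89.B4TorusGreen244 (KT)
open Literature.MathematicalPhysics.QuantumFieldTheory.Balaban1983to89.B5QGGQ145Bounds (Idx toZ)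
open Literature.MathematicalPhysics.QuantumFieldTheory.Balaban1983to89.B5QGGQ145Factor (KRe)
open Literature.MathematicalPhysics.QuantumFieldTheory.Balaban1983to89.B5DPD126Uniform (DKRe fup DKRe_eq_fdiff)
open Literature.MathematicalPhysics.QuantumFieldTheory.Balaban1983to89.B5PBridgeProjection (torIdx torIdx_apply)
open Literature.MathematicalPhysics.QuantumFieldTheory.Balaban1983to89.B5PBridgeKernel126 (torIdx_add_unitVec)
open Literature.MathematicalPhysics.QuantumFieldTheory.King1986.Torus (blockOf site site_eq_bpt lapF lapF_mulVec_apply Qmat fineOp minimiser blockProj transpose_Qmat_mulVec)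
open Summit.QuantumFields.YangMills.BalabanUVNodes.N15.DefectKernel (sum_fibre_blockOf)

variable {d : ℕ}

/-! ## §51 `Re(Δ + aQ′*Q′) = A₀(a, n², 0)`: b05's typed Green operator has real part King's fine operator -/

section Operators

variable (M : Fin (d + 1) → ℕ) [∀ μ, NeZero (M μ)] (n : ℕ) [NeZero n]

/-- the real part of b05's Laplacian acts as King's stencil `n²(−Δ) + 0`. [cite: Balaban1984PropagatorsI, (1.21) p.21; King1986, (4.4) p.670] -/
theorem reM_LapS_mulVec_apply (g : Tor (fine n M) → ℝ) (x : Tor (fine n M)) :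
    (reM (LapS (fine n M) (n : ℂ)) *ᵥ g) x = (lapF (fine n M) ((n : ℝ) ^ 2) 0 *ᵥ g) x := by
  rw [reM_mulVec_apply, LapS_mulVec, lapF_mulVec_apply, Complex.re_sum]
  have hterm : ∀ ν : Fin (d + 1), (conj (n : ℂ) * (n : ℂ) * (2 * ((g x : ℝ) : ℂ) - ((g (x + unitVec (fine n M) ν) : ℝ) : ℂ) - ((g (x - unitVec (fine n M) ν) : ℝ) : ℂ))).re
      = (n : ℝ) ^ 2 * (2 * g x - g (x + unitVec (fine n M) ν) - g (x - unitVec (fine n M) ν)) := by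
    intro ν
    rw [Complex.conj_natCast, show (n : ℂ) * (n : ℂ) * (2 * ((g x : ℝ) : ℂ) - ((g (x + unitVec (fine n M) ν) : ℝ) : ℂ) - ((g (x - unitVec (fine n M) ν) : ℝ) : ℂ))
      = (((n : ℝ) ^ 2 * (2 * g x - g (x + unitVec (fine n M) ν) - g (x - unitVec (fine n M) ν)) : ℝ) : ℂ) by push_cast; ring, Complex.ofReal_re]
  rw [Finset.sum_congr rfl fun ν _ => hterm ν, ← mul_sum, sum_sub_distrib, sum_sub_distrib, sum_const, card_univ, Fintype.card_fin, nsmul_eq_mul,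
    sum_add_distrib]
  push_cast
  ring

/-- the real part of `Q′*Q′` acts as King's block-mean projector `blockProj`. [cite: Balaban1984PropagatorsI, (1.20)–(1.21) pp.20–21; King1986, (4.1)–(4.3) p.670] -/
theorem reM_QsAdj_QsOp_mulVec_apply (g : Tor (fine n M) → ℝ) (x : Tor (fine n M)) :
    (reM (QsAdj n M * QsOp n M) *ᵥ g) x = (blockProj n M *ᵥ g) x := by
  classical
  have hn : (0 : ℝ) < (n : ℝ) ^ (d + 1) := pow_pos (by exact_mod_cast Nat.pos_of_ne_zero (NeZero.ne n)) _
  rw [reM_mulVec_apply, ← Matrix.mulVec_mulVec, QsAdj_mulVec, QsOp_mulVec, blockLabel_eq_blockOf]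
  -- RHS: the block mean over King's block of `x`
  have hR : (blockProj n M *ᵥ g) x = ((n : ℝ) ^ (d + 1))⁻¹ * ∑ j : Fin (d + 1) → Fin n, g (bpt n M (blockOf n M x) j) := by
    rw [Matrix.mulVec, dotProduct]
    have h1 : ∀ y, blockProj n M x y * g y = if blockOf n M y = blockOf n M x then ((n : ℝ) ^ (d + 1))⁻¹ * g y else 0 := by
      intro y
      simp only [blockProj]
      by_cases h : blockOf n M x = blockOf n M y
      · rw [if_pos h, if_pos h.symm]
      · rw [if_neg h, if_neg (Ne.symm h), zero_mul]
    rw [Finset.sum_congr rfl fun y _ => h1 y, ← Finset.sum_filter, ← mul_sum]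
    congr 1
    rw [show (univ.filter fun y => blockOf n M y = blockOf n M x) = fibre (blockOf n M) (blockOf n M x) from rfl, sum_fibre_blockOf]
    exact sum_congr rfl fun j _ => by rw [site_eq_bpt]
  rw [hR, show (1 / (n : ℂ) ^ (d + 1) * ∑ j : Fin (d + 1) → Fin n, ((g (bpt n M (blockOf n M x) j) : ℝ) : ℂ))
    = (((((n : ℝ) ^ (d + 1))⁻¹ * ∑ j : Fin (d + 1) → Fin n, g (bpt n M (blockOf n M x) j)) : ℝ) : ℂ) by push_cast; ring, Complex.ofReal_re]

/-- ★ **`Re(Δ + aQ′*Q′) = A₀(a, n², 0)`**: the real part of b05's typed Green operator of p. 25 IS King's fine operator `fineOp n M a (n²) 0 = n²(−Δ) + a·Q*Q` ((4.1)–(4.5) at `m² = 0`).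
[cite: Balaban1984PropagatorsI, p.25 (Δ′_a = Δ + aQ′*Q′); King1986, (4.1)–(4.5) p.670] -/
theorem reM_greenOp_eq_fineOp (a : ℝ) : reM (LapS (fine n M) (n : ℂ) + (a : ℂ) • (QsAdj n M * QsOp n M)) = fineOp n M a ((n : ℝ) ^ 2) 0 := by
  classical
  have hmv : ∀ g : Tor (fine n M) → ℝ, reM (LapS (fine n M) (n : ℂ) + (a : ℂ) • (QsAdj n M * QsOp n M)) *ᵥ g = fineOp n M a ((n : ℝ) ^ 2) 0 *ᵥ g := by
    intro g
    funext x
    rw [reM_add, reM_smul_ofReal, Matrix.add_mulVec, Matrix.smul_mulVec, Pi.add_apply, Pi.smul_apply, smul_eq_mul, reM_LapS_mulVec_apply,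
      reM_QsAdj_QsOp_mulVec_apply, fineOp, Matrix.add_mulVec, Matrix.smul_mulVec, Pi.add_apply, Pi.smul_apply, smul_eq_mul]
  ext i j
  have h := congrFun (hmv (Pi.single j 1)) i
  rwa [Matrix.mulVec_single_one, Matrix.mulVec_single_one] at h

/-- the typed Green operator is real. [cite: Balaban1984PropagatorsI, p.25] -/
theorem isReal_greenOp (a : ℝ) : IsReal (LapS (fine n M) (n : ℂ) + (a : ℂ) • (QsAdj n M * QsOp n M)) := by
  have hn : conj (n : ℂ) = n := Complex.conj_natCast n
  have hq : IsReal (QsAdj n M) := by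
    unfold QsAdj
    exact IsReal.smul (by rw [map_pow, Complex.conj_natCast]) (isReal_QsOp n M).conjTranspose
  exact (isReal_LapS (fine n M) hn).add (IsReal.smul (Complex.conj_ofReal a) (hq.mul (isReal_QsOp n M)))

end Operators

/-! ## §52 Charts: the box point of a unit site, `K_T`-vectors of indicators -/

section Box

variable (M : Fin (d + 1) → ℕ) [∀ μ, NeZero (M μ)] (n : ℕ) [NeZero n]

/-- `repZ = toZ ∘ torIdx`. [folklore] -/
theorem repZ_eq_toZ_torIdx (x : Tor (fine n M)) : repZ n M x = toZ (torIdx (fine n M) x) := rfl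

/-- the box point of `b` maps back to `b`. [folklore] -/
theorem castU_toZ_torIdx (b : Tor M) : castU M (toZ (torIdx M b)) = b := by
  funext ν
  simp only [castU, B5QGGQ145Bounds.toZ, torIdx_apply, B5RowSumsP12Lattice.chartSite_apply_val, Int.cast_natCast, ZMod.natCast_zmod_val]

/-- the box point of `b` lies in the box `Π[0, M_ν)`. [folklore] -/
theorem toZ_torIdx_mem_box (b : Tor M) : toZ (torIdx M b) ∈ Fintype.piFinset (fun i => Finset.Ico (0 : ℤ) (M i)) := by
  refine Fintype.mem_piFinset.mpr fun i => Finset.mem_Ico.mpr ⟨?_, ?_⟩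
  · exact Int.natCast_nonneg _
  · simp only [B5QGGQ145Bounds.toZ, torIdx_apply]
    exact_mod_cast (B5RowSumsP12Lattice.chartSite M b i).isLt

/-- a box point with residue `b` IS the box point of `b`. [folklore] -/
theorem eq_toZ_torIdx_of_castU_eq {y : Fin (d + 1) → ℤ} (hy : y ∈ Fintype.piFinset (fun i => Finset.Ico (0 : ℤ) (M i))) {b : Tor M}
    (h : castU M y = b) : y = toZ (torIdx M b) := by
  funext i
  have hyi := Finset.mem_Ico.mp (Fintype.mem_piFinset.mp hy i)
  have hb : ((y i : ℤ) : ZMod (M i)) = b i := congrFun h i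
  simp only [B5QGGQ145Bounds.toZ, torIdx_apply, B5RowSumsP12Lattice.chartSite_apply_val]
  rw [← hb, ZMod.val_intCast, Int.emod_eq_of_lt hyi.1 hyi.2]

/-- the `K_T`-vector of the indicator of `b` is one kernel value: `(K_T δ_b)(x) = K_T(repZ x, box point of b)`. [cite: Balaban1983RegularityDecay, (2.48) p.585] -/
theorem KTvec_indicator (a : ℝ) (b : Tor M) (x : Tor (fine n M)) :
    KTvec n M a (fun b' => if b' = b then 1 else 0) x = KT n a 0 M (repZ n M x) (toZ (torIdx M b)) := by
  classical
  rw [KTvec, Finset.sum_eq_single (toZ (torIdx M b))]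
  · rw [castU_toZ_torIdx, if_pos rfl, one_mul]
  · intro y hy hne
    rw [if_neg (fun h => hne (eq_toZ_torIdx_of_castU_eq M hy h)), zero_mul]
  · intro h; exact absurd (toZ_torIdx_mem_box M b) h

end Box

/-! ## §53 ★★ `K_T ↔ ℋ`: b04's Green kernel at `m² = 0` is King's block-spin minimiser kernel divided by `a` -/

section Minimiser

variable (M : Fin (d + 1) → ℕ) [∀ μ, NeZero (M μ)] (n : ℕ) [NeZero n]

/-- the indicator of King's block of `b`, as a real fine field. -/
private theorem transpose_Qmat_mulVec_single (b : Tor M) :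
    ((Qmat n M)ᵀ *ᵥ (Pi.single b (1 : ℝ))) = fun z => ((n : ℝ) ^ (d + 1))⁻¹ * (if blockOf n M z = b then 1 else 0) := by
  classical
  funext z
  rw [transpose_Qmat_mulVec]
  congr 1
  by_cases h : blockOf n M z = b
  · rw [h, Pi.single_eq_same, if_pos rfl]
  · rw [Pi.single_eq_of_ne h, if_neg h]

/-- ★★ **`K_T(x, b) = a⁻¹·ℋ(x, b)`**: b04's torus Green kernel of `(Δ + aQ′*Q′)⁻¹Q′*` at `m² = 0`, read at the charts of a fine site `x` and a unit site `b`, IS King's block-spin minimiser kernel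
`minimiser n M a (n²) 0 δ_b x = (a·n^{d+1}·A₀⁻¹Qᵀδ_b)(x)` divided by `a`. [cite: Balaban1984PropagatorsI, p.25 (G′ = (Δ + aQ′*Q′)⁻¹), p.38 ll.7–10; King1986, (2.13)–(2.15) p.653] -/
theorem KRe_torIdx_eq_minimiser {a : ℝ} (ha : 0 < a) (x : Tor (fine n M)) (b : Tor M) :
    KRe n a M (torIdx (fine n M) x) (torIdx M b) = a⁻¹ * minimiser n M a ((n : ℝ) ^ 2) 0 (Pi.single b 1) x := by
  classical
  have hn1 : 1 ≤ n := Nat.one_le_iff_ne_zero.mpr (NeZero.ne n)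
  have hnp : (0 : ℝ) < (n : ℝ) ^ (d + 1) := pow_pos (by exact_mod_cast Nat.pos_of_ne_zero (NeZero.ne n)) _
  set G := LapS (fine n M) (n : ℂ) + (a : ℂ) • (QsAdj n M * QsOp n M) with hG
  have hGR : IsReal G := isReal_greenOp M n a
  -- the source `Q′*δ_b` is the embedded block indicator
  set χ : Tor (fine n M) → ℝ := fun z => if blockOf n M z = b then 1 else 0 with hχ
  have hsrc : QsAdj n M *ᵥ (fun b' : Tor M => if b' = b then (1 : ℂ) else 0) = cplx χ := by
    funext z
    rw [QsAdj_mulVec, blockLabel_eq_blockOf]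
    simp only [cplx, hχ]
    split_ifs <;> simp
  -- LHS through the P-bridge
  have hL : KRe n a M (torIdx (fine n M) x) (torIdx M b) = ((reM G)⁻¹ *ᵥ χ) x := by
    have h1 : KRe n a M (torIdx (fine n M) x) (torIdx M b) = (KTvec n M a (fun b' => if b' = b then 1 else 0) x).re := by
      rw [KTvec_indicator, repZ_eq_toZ_torIdx]; rfl
    rw [h1, KTvec_eq_greenInv_mulVec n M hn1 ha, hsrc, ← hG, ← (hGR.inv).cplx_mulVec, B5RealFields.cplx_apply, Complex.ofReal_re,
      ← hGR.reM_inv (greenOp_mul_inv n M ha)]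
  -- RHS: King's minimiser of `δ_b`
  have hR : minimiser n M a ((n : ℝ) ^ 2) 0 (Pi.single b 1) x = a * ((fineOp n M a ((n : ℝ) ^ 2) 0)⁻¹ *ᵥ χ) x := by
    rw [minimiser, transpose_Qmat_mulVec_single, Pi.smul_apply, smul_eq_mul]
    rw [show (fun z => ((n : ℝ) ^ (d + 1))⁻¹ * (if blockOf n M z = b then (1 : ℝ) else 0)) = ((n : ℝ) ^ (d + 1))⁻¹ • χ from funext fun z => by simp [hχ],
      Matrix.mulVec_smul, Pi.smul_apply, smul_eq_mul]
    field_simp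
  rw [hL, hR, reM_greenOp_eq_fineOp, ← mul_assoc, inv_mul_cancel₀ ha.ne', one_mul]

/-- ★★ **`∂_μK_T(x, b) = a⁻¹·n·(ℋ(x + e_μ, b) − ℋ(x, b))`**: the (1.126) engine's gradient factor `DKRe` IS the forward unit-lattice difference quotient of King's minimiser kernel,
divided by `a` (`DKRe_eq_fdiff`, `torIdx_add_unitVec`). [cite: Balaban1983RegularityDecay, p.573 (difference derivative); King1986, Prop. 3.8 (3.71) p.664 (second line, object)] -/
theorem DKRe_torIdx_eq_minimiser {a : ℝ} (ha : 0 < a) (μ : Fin (d + 1)) (x : Tor (fine n M)) (b : Tor M) :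
    DKRe n a M μ (torIdx (fine n M) x) (torIdx M b)
      = a⁻¹ * ((n : ℝ) * (minimiser n M a ((n : ℝ) ^ 2) 0 (Pi.single b 1) (x + unitVec (fine n M) μ) - minimiser n M a ((n : ℝ) ^ 2) 0 (Pi.single b 1) x)) := by
  have hM1 : ∀ i, 1 ≤ M i := fun i => Nat.one_le_iff_ne_zero.mpr (NeZero.ne (M i))
  rw [DKRe_eq_fdiff n a hM1, ← torIdx_add_unitVec, KRe_torIdx_eq_minimiser M n ha, KRe_torIdx_eq_minimiser M n ha]
  ring

end Minimiser

end Summit.QuantumFields.YangMills.BalabanUVNodes.N15.TwoGrid
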